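import Summits.BirchSwinnertonDyer.BirchSwinnertonDyer.Theses.VerticalContact
import Literature.NumberTheory.EllipticCurves.BSDSelmerParityDokchitserBaseChangeProofs
import Literature.NumberTheory.EllipticCurves.ZpCorankStable
import Literature.NumberTheory.EllipticCurves.SelmerCorankAssembly
import Literature.NumberTheory.EllipticCurves.TwoPowerTorsion
import HarnessLib

/-!
# BirchSwinnertonDyer / VerticalContact — crux `VerticalSelmerBound` (stmt-BirchSwinnertonDyer-18432),
# line `toric_control`, stub `stub_selmerLengthLB`

Registered stub (skeleton `Cruxes/VerticalSelmerBound/Lines/toric_control.lean`): finite-level Selmer length is bounded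
below by the coranks: `p^(n·(corank Sel_p∞(E/ℚ) + corank Sel_p∞(E^{d_K}/ℚ))) ≤ #Sel^(p^n)(E/K) · p^c`.

Proof (with `c = 0`). By Dokchitser–Dokchitser, Lemma 4.14 (tree theorem
`selmerCorank_baseChange_quadratic_holds`) the exponent is `n · s` with `s = corank Sel_{p^∞}(E_K/K)`.
The `p`-primary group `A = Sel_{p^∞}(E_K/K)` has finite `p`-torsion (`finite_torsionBy_selmerGroupPInfty`),
so the chain `A[p] ∩ p^k A` stabilises and its stable value `C = p^k A` is a `p`-divisible subgroup with
`#C[p] = p^s` (`pow_zpCorank_eq_natCard_torsionBy_inf_range_of_stable`), whence `#C[p^n] = p^(n·s)`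
(`natCard_torsionBy_pow_of_nsmul_surjective`). Finally `C[p^n] ⊆ A[p^n]` and every `p^n`-torsion
class of `Sel_{p^∞}(E_K/K)` lifts to a class of `Sel^(p^n)(E_K/K)` along `H¹(K, E[p^n]) → H¹(K, E[p^∞])`
(the level-`p^n` version of `exists_mem_selmerGroup_torsionToPrimaryH1_eq` of `SelmerCorankAssembly`,
proved here on continuous cocycles exactly as there), and `Sel^(p^n)(E_K/K)` is finite
(Silverman X.4.2(b), `finite_selmerGroup_holds`), so `p^(n·s) = #C[p^n] ≤ #Sel^(p^n)(E_K/K)`.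

Sources: R. Greenberg, *Iwasawa theory for elliptic curves*, LNM 1716 (1999), §1–2, §5 p. 114;
T. Dokchitser–V. Dokchitser, Ann. of Math. 172 (2010), Lemma 4.14; Silverman, *AEC*, X.4.2.
-/

set_option linter.dupNamespace false

noncomputable section

namespace Summit.BirchSwinnertonDyer.BirchSwinnertonDyer.Theorems

open scoped BigOperators AddSubgroup
open Literature
open Literature.NumberTheory.EllipticCurves Literature.NumberTheory.GaloisRepresentations
open WeierstrassCurve

/-! ## The level-`p^n` Kummer lift `H¹(K, E[p^n]) ↠ H¹(K, E[p^∞])[p^n]` -/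

section Lift

variable {K : Type} [Field K] (E : WeierstrassCurve K) (p n : ℕ)

/-- `E[p^n] ⊆ E[p^∞]`. Silverman, *AEC*, III.§7. [folklore] -/
theorem vsbLB_geomTorsion_pow_le :
    geomTorsion E ((p ^ n : ℕ) : ℤ) ≤ geomPrimaryTorsion E p :=
  fun _ hP ↦ ⟨n, AddSubgroup.torsionBy.nsmul_iff.mp hP⟩

/-- **`H¹(K, E[p^n]) → H¹(K, E[p^∞]) → H¹(K, E)` is `H¹(K, E[p^n]) → H¹(K, E)`** (functoriality of
`H¹` in the coefficients, `resH1Hom_comp`). Serre, *Galois Cohomology*, I.§2.4. [folklore] -/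
theorem vsbLB_primaryH1ToH1_comp_lift :
    (primaryH1ToH1 E p).comp (resH1Hom (ContinuousMonoidHom.id (Field.absoluteGaloisGroup K))
        (AddSubgroup.inclusion (vsbLB_geomTorsion_pow_le E p n)) (fun _ _ ↦ rfl)) =
      torsionH1ToH1 E ((p ^ n : ℕ) : ℤ) := by
  rw [primaryH1ToH1, resH1Hom_comp, torsionH1ToH1_eq_resH1Hom]
  exact resH1Hom_congr rfl (AddMonoidHom.ext fun _ ↦ rfl) _ _

variable [hp : Fact p.Prime]

/-- `E[p^∞]` is `p^n`-divisible: every `a ∈ E[p^∞]` is `p^n • b` with `b ∈ E[p^∞]`, by the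
divisibility of `E(K̄)` (`zsmul_geomPoints_surjective_holds`, Silverman III.4.2(a) with II.2.3).
Greenberg (1999), §2, p. 62. [folklore] -/
theorem vsbLB_exists_pow_nsmul_eq_geomPrimaryTorsion [E.IsElliptic]
    (a : geomPrimaryTorsion E p) : ∃ b : geomPrimaryTorsion E p, p ^ n • b = a := by
  obtain ⟨k, hk⟩ := a.2
  obtain ⟨B, hB⟩ := exists_nsmul_eq_geomPoints E E.zsmul_geomPoints_surjective_holds
    (pow_ne_zero n hp.out.ne_zero) (a : geomPoints E)
  refine ⟨⟨B, ⟨k + n, ?_⟩⟩, Subtype.ext (by rw [AddSubgroupClass.coe_nsmul]; exact hB)⟩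
  rw [pow_add, mul_smul, hB]
  exact hk

/-- **`H¹(K, E[p^n]) ↠ H¹(K, E[p^∞])[p^n]`** for an elliptic curve: every class of `H¹(K, E[p^∞])`
killed by `p^n` is the image of a class of `H¹(K, E[p^n])` under the map induced by
`E[p^n] ↪ E[p^∞]`. On continuous cocycles: if `p^n [φ] = 0` then `p^n φ = ∂a`, `a = p^n b` in
`E[p^∞]`, and `φ - ∂b` takes values in `E[p^n]` (the surjection in the cohomology sequence of
`0 → E[p^n] → E[p^∞] → E[p^∞] → 0`; level-`p^n` version of `exists_torsionToPrimaryH1_eq`).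
Greenberg (1999), §5, p. 114. [folklore] -/
theorem vsbLB_exists_lift_eq [E.IsElliptic] {x : galH1Primary E p} (hx : p ^ n • x = 0) :
    ∃ y : galH1Torsion E ((p ^ n : ℕ) : ℤ),
      resH1Hom (ContinuousMonoidHom.id (Field.absoluteGaloisGroup K))
        (AddSubgroup.inclusion (vsbLB_geomTorsion_pow_le E p n)) (fun _ _ ↦ rfl) y = x := by
  obtain ⟨φ, rfl⟩ := oneCocycleClass_surjective _ x
  -- `p^n φ` is the coboundary of some `a = p^n • b`
  have h := oneCocycleClass_smul
    (discreteTopRep (Field.absoluteGaloisGroup K) (geomPrimaryTorsion E p)) ((p ^ n : ℕ) : ℤ) φ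
  conv at h => rhs; rw [Nat.cast_smul_eq_nsmul, hx]
  obtain ⟨a, ha⟩ := (oneCocycleClass_eq_zero_iff _ _).mp h
  have ha' : ∀ σ : Field.absoluteGaloisGroup K, p ^ n • φ.1 σ = σ • a - a := fun σ ↦ by
    rw [← natCast_zsmul]
    exact ha σ
  obtain ⟨b, rfl⟩ := vsbLB_exists_pow_nsmul_eq_geomPrimaryTorsion E p n a
  -- `φ - ∂b` takes values in `E[p^n]`
  set φ' := φ - cobCocycle b (continuous_smul_geomPrimaryTorsion E p b) with hφ'
  have hval : ∀ σ : Field.absoluteGaloisGroup K, p ^ n • φ'.1 σ = 0 := fun σ ↦ by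
    change p ^ n • (φ.1 σ - (σ • b - b)) = 0
    rw [smul_sub, ha', smul_sub, smul_comm, sub_self]
  have hmem : ∀ σ : Field.absoluteGaloisGroup K,
      ((φ'.1 σ : geomPrimaryTorsion E p) : geomPoints E) ∈ geomTorsion E ((p ^ n : ℕ) : ℤ) :=
    fun σ ↦ AddSubgroup.torsionBy.nsmul_iff.mpr (by
      rw [← AddSubgroupClass.coe_nsmul, hval σ, ZeroMemClass.coe_zero])
  let χ : contOneCocycles (discreteTopRep (Field.absoluteGaloisGroup K)
      (geomTorsion E ((p ^ n : ℕ) : ℤ))) :=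
    contOneCocycles.lift (AddSubgroup.inclusion (vsbLB_geomTorsion_pow_le E p n))
      (fun _ _ ↦ rfl) (AddSubgroup.inclusion_injective _) φ' (fun σ ↦ ⟨_, hmem σ⟩)
      (fun _ ↦ rfl)
  refine ⟨oneCocycleClass _ χ, ?_⟩
  rw [resH1Hom_id_oneCocycleClass, contOneCocycles.push_lift, hφ', oneCocycleClass_sub,
    oneCocycleClass_cobCocycle, sub_zero]

variable [NumberField K]

/-- **`Sel^(p^n)(E/K) ↠ Sel_{p^∞}(E/K)[p^n]`.** A class of the `p^∞`-Selmer group killed by `p^n`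
is the image of a class of the `p^n`-Selmer group under `H¹(K, E[p^n]) → H¹(K, E[p^∞])`: lift it
to `H¹(K, E[p^n])` (`vsbLB_exists_lift_eq`); the lift is a Selmer class because both Selmer groups
are the preimages of `Ш(E/K)` (`selmerGroup_eq_comap_sha`, `selmerGroupPInfty_eq_comap_sha`) under
maps that agree (`vsbLB_primaryH1ToH1_comp_lift`). Greenberg (1999), §2, p. 63; §5, p. 114.
[folklore] -/
theorem vsbLB_exists_mem_selmerGroup_lift_eq [E.IsElliptic] {x : galH1Primary E p}
    (hx : x ∈ selmerGroupPInfty E p) (hpx : p ^ n • x = 0) :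
    ∃ y ∈ selmerGroup E ((p ^ n : ℕ) : ℤ),
      resH1Hom (ContinuousMonoidHom.id (Field.absoluteGaloisGroup K))
        (AddSubgroup.inclusion (vsbLB_geomTorsion_pow_le E p n)) (fun _ _ ↦ rfl) y = x := by
  obtain ⟨y, rfl⟩ := vsbLB_exists_lift_eq E p n hpx
  refine ⟨y, ?_, rfl⟩
  rw [selmerGroup_eq_comap_sha, AddSubgroup.mem_comap, ← vsbLB_primaryH1ToH1_comp_lift E p n,
    AddMonoidHom.comp_apply]
  rw [selmerGroupPInfty_eq_comap_sha, AddSubgroup.mem_comap] at hx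
  exact hx

end Lift

/-! ## Counting: the divisible part of a `p`-primary group, and the Selmer bound -/

section Count

/-- **The divisible part of a `p`-primary group with finite `p`-torsion.** For a `p`-primary abelian
group `A` with finite `A[p]` there is a subgroup `C ≤ A` with `#C[p^n] = (p ^ zpCorank A p)^n` for
every `n`: the stable value `C = p^k A` of the chain `A[p] ∩ p^k A` (`exists_torsionBy_inf_range_stable`)
is `p`-divisible (`exists_nsmul_eq_of_stable`) with `#C[p] = #(A[p] ∩ C) = p ^ zpCorank A p`
(`pow_zpCorank_eq_natCard_torsionBy_inf_range_of_stable`), and `#C[p^n] = (#C[p])^n` for a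
`p`-divisible group (`natCard_torsionBy_pow_of_nsmul_surjective`). Greenberg, LNM 1716, §1
(corank of `(ℚ_p/ℤ_p)^ρ ⊕ F`). [folklore] -/
theorem vsbLB_exists_natCard_torsionBy_pow_eq {A : Type*} [AddCommGroup A] (p : ℕ) [Fact p.Prime]
    (hA : ∀ a : A, ∃ n : ℕ, p ^ n • a = 0) [Finite A[(p : ℤ)]] :
    ∃ C : AddSubgroup A, ∀ n : ℕ, Nat.card C[((p ^ n : ℕ) : ℤ)] = (p ^ zpCorank A p) ^ n := by
  obtain ⟨k, hst⟩ := exists_torsionBy_inf_range_stable (A := A) p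
  set C : AddSubgroup A := (nsmulAddMonoidHom (α := A) (p ^ k)).range with hC
  refine ⟨C, fun n ↦ ?_⟩
  have hcor : p ^ zpCorank A p = Nat.card ↥(A[(p : ℤ)] ⊓ C) :=
    pow_zpCorank_eq_natCard_torsionBy_inf_range_of_stable p hA hst
  -- `C` is `p`-divisible
  have hD : Function.Surjective fun d : C ↦ p • d := fun d ↦ by
    obtain ⟨m, hm⟩ := hA (d : A)
    obtain ⟨d', hd', h⟩ := exists_nsmul_eq_of_stable p hst m (d : A) d.2 hm
    exact ⟨⟨d', hd'⟩, Subtype.ext h⟩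
  -- `#C[p] = #(A[p] ∩ C)`
  haveI : Finite ↥(A[(p : ℤ)] ⊓ C) :=
    Finite.of_injective (AddSubgroup.inclusion (inf_le_left : A[(p : ℤ)] ⊓ C ≤ A[(p : ℤ)]))
      (AddSubgroup.inclusion_injective _)
  have h3 : Nat.card C[(p : ℤ)] = Nat.card ↥(A[(p : ℤ)] ⊓ C) := by
    refine Nat.card_congr (Equiv.ofBijective
      (fun x : C[(p : ℤ)] ↦ (⟨((x : C) : A), AddSubgroup.mem_inf.mpr ⟨?_, (x : C).2⟩⟩ :
        ↥(A[(p : ℤ)] ⊓ C))) ⟨?_, ?_⟩)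
    · rw [AddSubgroup.torsionBy.nsmul_iff, ← AddSubgroupClass.coe_nsmul,
        AddSubgroup.torsionBy.nsmul_iff.mp (x : C[(p : ℤ)]).2, ZeroMemClass.coe_zero]
    · intro x y hxy
      have h := congrArg Subtype.val hxy
      exact Subtype.ext (Subtype.ext h)
    · rintro ⟨a, ha⟩
      obtain ⟨ha₁, ha₂⟩ := AddSubgroup.mem_inf.mp ha
      refine ⟨⟨⟨a, ha₂⟩, AddSubgroup.torsionBy.nsmul_iff.mpr (Subtype.ext ?_)⟩, rfl⟩
      rw [AddSubgroupClass.coe_nsmul, ZeroMemClass.coe_zero]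
      exact AddSubgroup.torsionBy.nsmul_iff.mp ha₁
  exact natCard_torsionBy_pow_of_nsmul_surjective hD (h3.trans hcor.symm) n

variable {K : Type} [Field K] [NumberField K] (E : WeierstrassCurve K) [E.IsElliptic] (p : ℕ)
  [hp : Fact p.Prime]

/-- **`p^(n · corank Sel_{p^∞}(E/K)) ≤ #Sel^(p^n)(E/K)`** for an elliptic curve `E` over a number
field `K`, a prime `p` and every `n`. With `A = Sel_{p^∞}(E/K)` (`p`-primary,
`exists_pow_nsmul_eq_zero_galH1Primary`, with finite `p`-torsion, `finite_torsionBy_selmerGroupPInfty`)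
and `C ≤ A` its divisible part (`vsbLB_exists_natCard_torsionBy_pow_eq`): `#C[p^n] = p^(n·s)`, and
choosing for each class of `C[p^n] ⊆ A[p^n]` a preimage in `Sel^(p^n)(E/K)`
(`vsbLB_exists_mem_selmerGroup_lift_eq`) embeds `C[p^n]` into the finite (`finite_selmerGroup_holds`,
Silverman X.4.2(b)) group `Sel^(p^n)(E/K)`. Greenberg (1999), §1, p. 55; §5, p. 114. [folklore] -/
theorem vsbLB_pow_mul_selmerCorank_le_natCard_selmerGroup (n : ℕ) :
    p ^ (n * E.selmerCorank p) ≤ Nat.card (selmerGroup E ((p : ℤ) ^ n)) := by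
  have hA : ∀ a : selmerGroupPInfty E p, ∃ k : ℕ, p ^ k • a = 0 := fun a ↦ by
    obtain ⟨k, hk⟩ := exists_pow_nsmul_eq_zero_galH1Primary E p (a : galH1Primary E p)
    exact ⟨k, Subtype.ext (by rw [AddSubmonoidClass.coe_nsmul, hk, ZeroMemClass.coe_zero])⟩
  haveI : Finite (selmerGroupPInfty E p)[(p : ℤ)] := finite_torsionBy_selmerGroupPInfty E p
  obtain ⟨C, hC⟩ := vsbLB_exists_natCard_torsionBy_pow_eq p hA
  haveI : Finite (selmerGroup E ((p ^ n : ℕ) : ℤ)) :=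
    E.finite_selmerGroup_holds (Int.natCast_ne_zero.mpr (pow_ne_zero n hp.out.ne_zero))
  -- the classes of `C[p^n]` lie in `Sel_{p^∞}(E/K)` and are killed by `p^n`
  have hx : ∀ x : C[((p ^ n : ℕ) : ℤ)],
      (((x : C) : selmerGroupPInfty E p) : galH1Primary E p) ∈ selmerGroupPInfty E p ∧
        p ^ n • (((x : C) : selmerGroupPInfty E p) : galH1Primary E p) = 0 := fun x ↦
    ⟨((x : C) : selmerGroupPInfty E p).2, by
      have h := congrArg (fun z : C ↦ ((z : selmerGroupPInfty E p) : galH1Primary E p))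
        (AddSubgroup.torsionBy.nsmul_iff.mp x.2)
      simpa only [AddSubmonoidClass.coe_nsmul, ZeroMemClass.coe_zero] using h⟩
  -- chosen lifts to `Sel^(p^n)(E/K)` embed `C[p^n]`
  choose f hf hfx using fun x : C[((p ^ n : ℕ) : ℤ)] ↦
    vsbLB_exists_mem_selmerGroup_lift_eq E p n (hx x).1 (hx x).2
  have key : Nat.card C[((p ^ n : ℕ) : ℤ)] ≤ Nat.card (selmerGroup E ((p ^ n : ℕ) : ℤ)) := by
    refine Nat.card_le_card_of_injective
      (fun x ↦ (⟨f x, hf x⟩ : selmerGroup E ((p ^ n : ℕ) : ℤ))) fun x y hxy ↦ ?_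
    have h1 : f x = f y := congrArg Subtype.val hxy
    have h2 := hfx x
    rw [h1, hfx y] at h2
    exact Subtype.ext (Subtype.ext (Subtype.ext h2.symm))
  calc p ^ (n * E.selmerCorank p) = (p ^ E.selmerCorank p) ^ n := by rw [mul_comm, pow_mul]
    _ = Nat.card C[((p ^ n : ℕ) : ℤ)] := (hC n).symm
    _ ≤ Nat.card (selmerGroup E ((p ^ n : ℕ) : ℤ)) := key
    _ = Nat.card (selmerGroup E ((p : ℤ) ^ n)) := by rw [Nat.cast_pow]

end Count

/-- **Finite-level Selmer length is bounded below by the coranks** (stub `stub_selmerLengthLB` of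
line `toric_control`, crux `VerticalSelmerBound`). For an elliptic curve `E/ℚ`, a prime `p` and a
quadratic field `K`, there is `c` (in fact `c = 0`) with
`p^(n·(corank Sel_{p^∞}(E/ℚ) + corank Sel_{p^∞}(E^{d_K}/ℚ))) ≤ #Sel^(p^n)(E/K) · p^c` for all `n`.
Proof: the exponent is `n · corank Sel_{p^∞}(E_K/K)` (Dokchitser–Dokchitser 2010, Lemma 4.14:
`selmerCorank_baseChange_quadratic_holds`), and `p^(n · corank Sel_{p^∞}(E_K/K)) ≤ #Sel^(p^n)(E_K/K)`
by the divisible part of `Sel_{p^∞}(E_K/K)` and the surjection `Sel^(p^n)(E_K/K) ↠ Sel_{p^∞}(E_K/K)[p^n]`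
(`vsbLB_pow_mul_selmerCorank_le_natCard_selmerGroup`). Greenberg (1999), §1–2;
Dokchitser–Dokchitser, Ann. of Math. 172 (2010), Lemma 4.14; Silverman, *AEC*, X.4.2. -/
theorem stub_selmerLengthLB :
    ∀ (W : WeierstrassCurve ℚ) [W.IsElliptic] (p : ℕ) [Fact p.Prime] (K : Type) [Field K] [NumberField K], Module.finrank ℚ K = 2 → ∃ c : ℕ, ∀ n : ℕ, p ^ (n * (W.selmerCorank p + (W.quadraticTwist (NumberField.discr K : ℚ)).selmerCorank p)) ≤ Nat.card ↥((W.baseChange K).selmerGroup ((p : ℤ) ^ n)) * p ^ c := by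
  intro W _ p _ K _ _ h2
  haveI : (W.baseChange K).IsElliptic := by rw [WeierstrassCurve.baseChange]; infer_instance
  refine ⟨0, fun n ↦ ?_⟩
  rw [← selmerCorank_baseChange_quadratic_holds W K h2 p, pow_zero, mul_one]
  exact vsbLB_pow_mul_selmerCorank_le_natCard_selmerGroup (W.baseChange K) p n

end Summit.BirchSwinnertonDyer.BirchSwinnertonDyer.Theorems
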